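import Summits.NavierStokesRegularity.NavierStokesRegularity.Theorems.ScenarioCensusRowF1SharpTop
import HarnessLib

/-!
# LINE 28 «sharp-top» port, part 3/4: §12 (end) the critical level as a speed threshold (`critLevel_lt_norm_iff`, `critLevel_mono`)

Re-homed for the scenario census (typer seat ns-census-typer-1 g9; the cell F1xf♯ and the floor DSX are MEMBERS OF RECORD «DECIDED IN KERNEL IN FILES» of row F1 since
census v1.81 (critic idea-crit-3 g8 PASS 04:49Z — no price; ref ns-census-ref g11 PRE-CHECK ✓ §16.4 item 49; lead-presearch label); this port makes them TREE-decided):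
VERBATIM PORT of the NEW sections (§8♯, §12, §13) of ns-idea-3 LINE 28 «sharp-top», `pub/ideators/ns-idea-3/lines/sharp-top/line-sharp-top.lean` sha16 3f3b055f6f2a207c
(2536 l., lean check rc 0, 0 sorry; its §1–§5 / §8 / §9–§11 = LINE 27 «liouville-socket» 01bcb6dd501a8321 byte-identical — 106/106 declarations, taken BY NAME from
`ScenarioCensusRowF1Socket*`), split for the 400-line rule into `ScenarioCensusRowF1SharpTop` (§8♯) → `…SharpTopDom` (§12) → `…SharpTopCrit` (§12 end: the critical level as a speed threshold) → `…SharpTopRow` (§13 + census KEYS); each part imports only the parts it uses.  Lean text VERBATIM in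
namespace `…Theorems.ScenarioCensus.SharpTop` (the line's `…Cruxes.ScenarioCensusRowF1.SharpTopLine` re-homed) with `open …ScenarioCensus.LiouvilleSocket`; port edits:
the bracket lines `section IntegralTransferCrit` / `end …` dropped (no `variable`s), `@[conjecture]` on the residual `SharpSlack` (≡ `ScenarioCensus.Row_F1`, OPEN),
one-line docstrings added where missing (gate lint); `norm_cross_le` is the Literature lemma `norm_cross_le_mul_norm` taken BY NAME and the display `rowF1xf_holds'` (a second proof term of LINE 27's row) is not re-declared.  Statements untouched.

No census VALUE is moved here (row F1 stays OPEN-WITH-LINE; the member becomes TREE-decided by name); NS regularity is NOT proved; `Row_F1` is untouched (zero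
movement, `sharpSlack_iff_rowF1`); no summit statement is proved by this file. Lemmas that restate already-landed tree declarations are taken BY NAME (gate lint `dedup.landed`): `fderiv_smul_stPull_apply` = `InviscidTop.fderiv_smul_stPull_apply`, `fderiv_smul_stPull` = `InviscidTop.fderiv_smul_stPull`, `fderiv_fderiv_smul_stPull` = `InviscidTop.fderiv_fderiv_smul_stPull`, `tendsto_clm_of_tendsto_apply` = `InviscidTop.tendsto_clm_of_tendsto_apply`, `tendsto_fderiv_fderiv_apply_of_bound` = `InviscidTop.tendsto_fderiv_fderiv_apply_of_bound`, `tendsto_fderiv_fderiv_of_bound` = `InviscidTop.tendsto_fderiv_fderiv_of_bound`, `tendsto_fderiv_fderiv_of_typeI_seq_Ioo` = `InviscidTop.tendsto_fderiv_fderiv_of_typeI_seq_Ioo`, `fderiv3_smul_stPull` = `FrozenTop.fderiv3_smul_stPull`, `tendsto_fderiv3_of_typeI_seq_Ioo` = `FrozenTop.tendsto_fderiv3_of_typeI_seq_Ioo`, `tendsto_physicalTime` = `ColumnarTop.tendsto_physicalTime`, `eventually_fast` = `ColumnarTop.eventually_fast`, `sqrt_timeLag` = `StretchedTop.sqrt_timeLag`,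 `forall_of_forall_ne_zero` = `StretchedTop.forall_of_forall_ne_zero`, `radius_eq` = `FrozenTop.radius_eq`, `jointCond_everywhere₆` = `FrozenTop.jointCond_everywhere₄`, `continuousOn_quad` = `IntegratedStretch.continuousOn_quad`, `sqrt_nu_timeLag` = `IntegratedStretch.sqrt_nu_timeLag`, `sing_of_not_bounded` = `InviscidTop.sing_of_not_bounded`, `exists_singularZoom_package₃` = `FrozenTop.exists_singularZoom_package₃`, `lapD_eq_zero_of_eq_zero` = `FrozenTop.lapD_eq_zero_of_eq_zero`, `measurableSet_top` = `IntegratedStretch.measurableSet_top`, `norm_cross_le` = `norm_cross_le_mul_norm`.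
-/

-- the summit and its single problem share the name `NavierStokesRegularity` (D-0017 nested layout)
set_option linter.dupNamespace false

noncomputable section

open MeasureTheory Set Function Filter TopologicalSpace Metric
open scoped Topology NNReal ENNReal InnerProductSpace RealInnerProductSpace Laplacian

namespace Summit.NavierStokesRegularity.NavierStokesRegularity.Theorems.ScenarioCensus.SharpTop

open Literature.Analysis Literature.Analysis.FluidPDE
open Summit.NavierStokesRegularity.NavierStokesRegularity.Theorems
open Summit.NavierStokesRegularity.NavierStokesRegularity.Theorems.ScenarioCensus.LiouvilleSocket

/-! ### The critical level as a speed threshold; antitonicity -/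

/-- `Λ♯_κ(t) < |u|` iff `κν/(T − t) < |u|²` (`0 ≤ κ`, `t < T`). -/
theorem critLevel_lt_norm_iff {T ν κ t : ℝ} (hκ : 0 ≤ κ) (hν : 0 ≤ ν) (ht : t < T) (v : E3) :
    critLevel T ν κ t < ‖v‖ ↔ κ * (ν * (T - t)⁻¹) < ‖v‖ ^ 2 := by
  rw [← critLevel_sq hκ hν ht, pow_lt_pow_iff_left₀ (critLevel_nonneg _ _ _ _) (norm_nonneg _) two_ne_zero]

/-- The critical level is monotone in the fraction (for `t < T`). -/
theorem critLevel_mono {T ν κ₁ κ₂ t : ℝ} (h : κ₁ ≤ κ₂) (hν : 0 ≤ ν) (ht : t < T) :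
    critLevel T ν κ₁ t ≤ critLevel T ν κ₂ t := by
  unfold critLevel
  exact Real.sqrt_le_sqrt (mul_le_mul_of_nonneg_right h (mul_nonneg hν (inv_nonneg.2 (sub_pos.2 ht).le)))

end Summit.NavierStokesRegularity.NavierStokesRegularity.Theorems.ScenarioCensus.SharpTop

end
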